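import Summits.BirchSwinnertonDyer.BirchSwinnertonDyer.Theses.UniversalToricDescent
import Summits.BirchSwinnertonDyer.BirchSwinnertonDyer.Theorems.SchneiderFreeAdditiveX3KYBranchHalvesLambdaLe
import Summits.BirchSwinnertonDyer.BirchSwinnertonDyer.Theorems.EisensteinPrimesHidaLimitFittingBoundConverse
import HarnessLib

/-!
# NODE (D-0171) on crux stmt-BirchSwinnertonDyer-24207 `UniversalToricDescent.RationalSplitIMCInclusionAtThree`
# — line `eisenstein_kato_swap` (crux-ideate seat `cruxidea-stmt-BirchSwinnertonDyer-24207-1` gen 0, 2026-08-29)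

KIND: IMPLIED-BY (a sufficient PAIR, not an equivalence — no child route; `no_new_routes`).
`closes`-analogue CHECKED below (kernel, 0 sorry):
`rationalSplitIMCInclusionAtThree_of_eisenstein_of_lambdaDominance :
   EisensteinRationalInclusionAtThree → CharLambdaDominanceAtThree → UTD.RationalSplitIMCInclusionAtThree` (BY NAME).

THE MOVE (Weierstrass «λ-flip»). 24207 is the RATIONAL Kato-direction inclusion `∃ k, 3^k·L ∈ Ch_Λ(X_(∅,0))·R₀⟦T⟧`
(`Ch ∣ 3^k L`). In `R₀⟦T⟧` a divisibility between two nonzero elements with the SAME slack-free degree is an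
equality of ideals up to `3`-powers (`KYBranchHalves.span_singleton_eq_of_C_pow_mul_mem_of_le`: one divisibility with
slack + the ONE-SIDED inequality of first-unit-coefficient indices ⇒ equality). Hence the REVERSE rational inclusion
(Eisenstein side, P1: `∃ k, 3^k·Ch ⊆ (L)`) together with the one-sided DEGREE inequality `λ(Ch) ≤ λ(L)` (P2) forces
`(L₀) = (F₀)` for the `3`-free parts and therefore 24207 with `k = a` (`a` = the `3`-exponent of the generator).
So the E-side research input of UTD's rational road can be taken on the EISENSTEIN side — where the catalogued
barriers of the cell (`TraceZeroHeegnerTowerAtAdditiveSplitP`, `NoAdmissiblePrimesAtThree`: no norm-compatible /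
Kolyvagin object for `T₃E` at the trace-zero prime) do not quantify, because congruence methods never use a
`U₃`-eigenvector of `f_E` — and the KATO side is moved to the TWIN `E′` (semistable / good at 3, where Λ-adic Heegner
classes exist: Howard's half), entering P2 through the route's own `λ`/`σ` transport.

PIECES AND TAGS (evidence):
* P1 `EisensteinRationalInclusionAtThree` — **UNDECIDED** (research). Statement = the registered LEVER stub
  `stub_semiOrdinaryTransferUpToPPower` of route SemiOrdinaryEisensteinDescent's crux E
  `WildSplitEisensteinInclusionAtThree` (stmt-BirchSwinnertonDyer-20479, skeleton sha16 4d547c0373835491,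
  `Cruxes/WildSplitEisensteinInclusionAtThree/Lines/birth.lean`) VERBATIM: binders of 24207, torsion guard, conclusion
  `∃ k, ∀ x ∈ Ch·R₀⟦T⟧, 3^k·x ∈ (L)`. Evidence: item 20479 open, prover line `birth` dead ×5 (no proof from the tree —
  `Lines/birth-dead*.md`), no refutation, not in `ledger negatives`; engines in print only at p ≥ 5 / square-free N
  ([corpus:paper:arxiv-2405.00270 p.3 L31–34: Wan20 U(3,1) needs N square-free; p.5 L74–76: the GU(2,2) strategy
  «also applies for p = 3; the only missing ingredient is [Wan15] which assumes p > 3 only for a comparison of certain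
  automorphic periods»; p.7 L49–50: Wan15 Thm 4 is «up to tensoring with ℚ_p» = rational currency]).
  LEAF: IDEA-NEEDED (p-local Fourier–Jacobi / doubling integral at a supercuspidal π₃ of conductor 3^f, f ∈ {3,4,5},
  inside a SEMI-ORDINARY U(3,1) family; Wan arXiv:1412.1767 Thm 1.1 is the solved sibling) — SHARED with SOED 20479.
* P2 `CharLambdaDominanceAtThree` — **WEAKER** (a consequence of 24207 at every frame with `L ≠ 0`): if `X` is torsion,
  `Ch·R₀⟦T⟧ = (F)` is principal and nonzero (`ThinCombLine.stub_charIdealPrincipal` p692284), `F = C(3^a)·F₀`,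
  `L = C(3^c)·L₀` with first unit coefficients at `m`, `n` (`exists_eq_C_pow_mul_regular_unrSeries`), and 24207's
  `F ∣ 3^k L` gives `F₀ ∣ 3^{k+c} L₀`, whence `m ≤ n` (`dvd_of_mem_of_C_pow_mul_mem_span`, `firstUnitCoeff_le_of_dvd`).
  LEAF: ATTACKABLE (print-pattern) — supply chain = route transport mirrored: `m = λ(X_(∅,0)(E)) = λ(X_(∅,0)(E′))`
  (Greenberg–Vatsal for the (∅,0) structure, whose local conditions at 𝔭, 𝔭′ do not see the reduction type; tree
  pattern `UniversalToricDescentLambdaTransport.lambdaInvariant_eq_of_torsionIso`; μ = 0 from `TwinAlgMuZeroAtThree`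
  24737), `λ(X′) ≤ λ(L′)` = the twin KATO degree frame `TwinKatoDegreeFrameAtThreeMultTresT` below (Howard's half:
  Λ-adic Heegner/BDP Kolyvagin system for the multiplicative resp. a₃ = 0 twin — Howard 2004 Thm B, Castella 2020
  JIMJ, Castella–Wan; p ≥ 5 in print, p = 3 port), `λ(L′) = λ(L) = n` (`SigmaCongruenceAtThree` 27120 + Hsieh 2014
  Thm B μ = 0, support 20711). This is the MIRROR of the route's ♭B′°/♭C₀° degree clauses 22539/22540 (there
  `m ≤ n` reads λ(L′) ≤ λ(X′), the WAN direction, research per 24017: «no printed Eisenstein-side engine at p = 3»).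
* LEAF def `TwinKatoDegreeFrameAtThreeMultTresT` — **ATTACKABLE**: item 22539's text VERBATIM with the final
  inequality reversed (`n ≤ m`, i.e. λ(Ch X′) ≤ λ(L′)); typed only, consumed by no theorem here (its descent to P2 needs
  the transport items' binders; left to a crux-plan seat).

WHY EASIER / WHY NOVEL (one sentence each). Easier: the pair {P1, P2} replaces the road's TWO research engines
{E-side Kato at a trace-zero prime (24207's `stub_ratCombDivisibility[UpTo]`, beyond print: no Λ-adic object),
twin-side Wan at p = 3 (24017/22539/22540: no engine)} by ONE research engine (P1 = SOED's lever, a congruence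
statement immune to the trace-zero barrier, natural in rational currency) plus Howard's half on the twin (print
pattern). Novel: every line and card on 24207/20395 (thin_comb v1–v3, universal-toric-half-order, base-doubling-tau-
signs, axis-carrier, epsilon-supply, …) manufactures classes or Coleman maps for `f_E` AT the wild prime; the tree's
cross-route file `…WildSplitEisensteinInclusionAtThreeReplacesToricWall` swaps SOED's INTEGRAL E for UTD's INTEGRAL
wall 20395 through the full norm-profile transport 20399 (λ AND μ, conjecture-grade at 9 ∣ N); nobody recorded the
RATIONAL shadow — that the rational wall 24207 needs only the RATIONAL Eisenstein inclusion and ONE λ-inequality,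
and that this inequality is the twin's KATO half, not its Wan half.

INSTRUMENT DATA: none run (kit 0). D-g55-1 (universal-toric-half-order) remains unrun (pub/bsd-wall INBOX l.1254).
HONEST STATUS: P1 is research (= SOED's crux after inverting 3); nothing here proves BSD for any curve; no sorry,
no new axiom, no named fact consumed.
-/

set_option autoImplicit false
set_option linter.dupNamespace false

noncomputable section

open scoped Classical

namespace Summit.BirchSwinnertonDyer.BirchSwinnertonDyer.Cruxes.RationalSplitIMCInclusionAtThree.EisensteinKatoSwap

open PowerSeries Literature.NumberTheory.EllipticCurves Literature.NumberTheory.EllipticCurves.KellerYin2024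
  Summit.BirchSwinnertonDyer.Rank1Residual.X11b
  Summit.BirchSwinnertonDyer.BirchSwinnertonDyer.Theorems.SchneiderFreeAdditiveX3.KYBranchHalves

/-- **P1 [UNDECIDED · leaf IDEA-NEEDED, shared with SOED 20479]** the RATIONAL Eisenstein-side inclusion at the wild
split prime 3: under 24207's binders, if `X_(∅,0)(E/K_∞)` is Λ-torsion then `∃ k, 3^k · Ch_Λ(X_(∅,0))·R₀⟦T⟧ ⊆ (L)`
(= SOED `stub_semiOrdinaryTransferUpToPPower`, verbatim). -/
def EisensteinRationalInclusionAtThree : Prop :=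
  ∀ (W : WeierstrassCurve ℚ) [W.IsElliptic] [W.IsGloballyMinimal] (N : ℕ) [NeZero N] (K : Type) [Field K] [NumberField K] (Dt : Literature.NumberTheory.EllipticCurves.ModularForms.ModularParametrizationData W N), Summit.BirchSwinnertonDyer.Rank1Residual.Additive.ClassO6 W 3 → W.HasSurjectiveModNGaloisRep 3 → W.analyticRank = 1 → W.conductorNorm ℤ = N → Literature.NumberTheory.EllipticCurves.IsImaginaryQuadratic K → Literature.NumberTheory.EllipticCurves.SatisfiesHeegnerHypothesis N K → ∀ (κ : Literature.NumberTheory.EllipticCurves.ZpExtension K 3), κ.IsAnticyclotomic → ∀ (γ : Field.absoluteGaloisGroup K) [Fact (κ.IsTopGenerator γ)] (𝔭 : IsDedekindDomain.HeightOneSpectrum (NumberField.RingOfIntegers K)), ((3 : ℕ) : NumberField.RingOfIntegers K) ∈ 𝔭.asIdeal → 𝔭.asIdeal.ramificationIdx (NumberField.RingOfIntegers ℚ) = 1 → 𝔭.asIdeal.inertiaDeg (NumberField.RingOfIntegers ℚ) = 1 → ∀ (𝔭' : IsDedekindDomain.HeightOneSpectrum (NumberField.RingOfIntegers K)), ((3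 : ℕ) : NumberField.RingOfIntegers K) ∈ 𝔭'.asIdeal → 𝔭' ≠ 𝔭 → ∀ (ι' : PadicAlgCl 3 ≃+* ℂ), Summit.BirchSwinnertonDyer.BirchSwinnertonDyer.Theorems.SchneiderFree.BranchInducesPrime 3 ι' 𝔭 → ∀ (ΩK : ℂ) (Ωp : ℂ_[3]) (L : Literature.NumberTheory.EllipticCurves.UnrSeries 3), ΩK ≠ 0 → Ωp ≠ 0 → Literature.NumberTheory.EllipticCurves.IsBDPLFunction ι' 𝔭 κ γ Dt.f ΩK Ωp L → Module.IsTorsion (Literature.NumberTheory.EllipticCurves.IwasawaAlgebra 3) (Summit.BirchSwinnertonDyer.Rank1Residual.X11b.AcSelmer.XAc (W.baseChange K) 3 κ 𝔭' ∅ γ) → ∃ k : ℕ, ∀ x ∈ ((Summit.BirchSwinnertonDyer.Rank1Residual.X11b.AcSelmer.XAc.charIdeal (W.baseChange K) 3 κ 𝔭' ∅ γ).map (PowerSeries.map (Summit.BirchSwinnertonDyer.Rank1Residual.X11b.Halves.toUnr 3))), (3 : Literature.NumberTheory.EllipticCurves.UnrSeries 3) ^ k * x ∈ Ideal.span {L}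

/-- **P2 [WEAKER · leaf ATTACKABLE]** one-sided degree dominance `λ(Ch X_(∅,0)(E)) ≤ λ(L)` in the route's profile
vocabulary: under 24207's binders, if `X` is torsion and `L ≠ 0`, the extended characteristic ideal is principal with
generator `F = C(3^a)·F₀`, `L = C(3^c)·L₀`, `F₀`, `L₀` having first unit coefficients at `m ≤ n`. -/
def CharLambdaDominanceAtThree : Prop :=
  ∀ (W : WeierstrassCurve ℚ) [W.IsElliptic] [W.IsGloballyMinimal] (N : ℕ) [NeZero N] (K : Type) [Field K] [NumberField K] (Dt : Literature.NumberTheory.EllipticCurves.ModularForms.ModularParametrizationData W N), Summit.BirchSwinnertonDyer.Rank1Residual.Additive.ClassO6 W 3 → W.HasSurjectiveModNGaloisRep 3 → W.analyticRank = 1 → W.conductorNorm ℤ = N → Literature.NumberTheory.EllipticCurves.IsImaginaryQuadratic K → Literature.NumberTheory.EllipticCurves.SatisfiesHeegnerHypothesis N K → ∀ (κ : Literature.NumberTheory.EllipticCurves.ZpExtension K 3), κ.IsAnticyclotomic → ∀ (γ : Field.absoluteGaloisGroup K) [Fact (κ.IsTopGenerator γ)] (𝔭 : IsDedekindDomain.HeightOneSpectrum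 (NumberField.RingOfIntegers K)), ((3 : ℕ) : NumberField.RingOfIntegers K) ∈ 𝔭.asIdeal → 𝔭.asIdeal.ramificationIdx (NumberField.RingOfIntegers ℚ) = 1 → 𝔭.asIdeal.inertiaDeg (NumberField.RingOfIntegers ℚ) = 1 → ∀ (𝔭' : IsDedekindDomain.HeightOneSpectrum (NumberField.RingOfIntegers K)), ((3 : ℕ) : NumberField.RingOfIntegers K) ∈ 𝔭'.asIdeal → 𝔭' ≠ 𝔭 → ∀ (ι' : PadicAlgCl 3 ≃+* ℂ), Summit.BirchSwinnertonDyer.BirchSwinnertonDyer.Theorems.SchneiderFree.BranchInducesPrime 3 ι' 𝔭 → ∀ (ΩK : ℂ) (Ωp : ℂ_[3]) (L : Literature.NumberTheory.EllipticCurves.UnrSeries 3), ΩK ≠ 0 → Ωp ≠ 0 → Literature.NumberTheory.EllipticCurves.IsBDPLFunction ι' 𝔭 κ γ Dt.f ΩK Ωp L → Module.IsTorsion (Literature.NumberTheory.EllipticCurves.IwasawaAlgebra 3) (Summit.BirchSwinnertonDyer.Rank1Residual.X11b.AcSelmer.XAc (W.baseChange K) 3 κ 𝔭' ∅ γ) →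 L ≠ 0 → ∃ (F F₀ L₀ : Literature.NumberTheory.EllipticCurves.UnrSeries 3) (a m c n : ℕ), (Summit.BirchSwinnertonDyer.Rank1Residual.X11b.AcSelmer.XAc.charIdeal (W.baseChange K) 3 κ 𝔭' ∅ γ).map (PowerSeries.map (Summit.BirchSwinnertonDyer.Rank1Residual.X11b.Halves.toUnr 3)) = Ideal.span {F} ∧ F = PowerSeries.C (((3 : ℕ) : Literature.NumberTheory.EllipticCurves.unrIntegers 3) ^ a) * F₀ ∧ Literature.NumberTheory.EllipticCurves.KellerYin2024.FirstUnitCoeffAt F₀ m ∧ L = PowerSeries.C (((3 : ℕ) : Literature.NumberTheory.EllipticCurves.unrIntegers 3) ^ c) * L₀ ∧ Literature.NumberTheory.EllipticCurves.KellerYin2024.FirstUnitCoeffAt L₀ n ∧ m ≤ n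

/-- **LEAF for P2 [ATTACKABLE]** the twin KATO degree frame on the très ramifié multiplicative twin bucket (Howard's
half): item 22539 `TwinDegreeFrameAtThreeMultTresT` VERBATIM with the final inequality reversed (`n ≤ m`:
λ(Ch X′_(∅,0)) ≤ λ(L′)). Typed only. -/
def TwinKatoDegreeFrameAtThreeMultTresT : Prop :=
  ∀ (W' : WeierstrassCurve ℚ) [W'.IsElliptic] [W'.IsGloballyMinimal] (N' : ℕ) [NeZero N'] (K : Type) [Field K] [NumberField K] (Dt' : Literature.NumberTheory.EllipticCurves.ModularForms.ModularParametrizationData W' N'), Literature.NumberTheory.EllipticCurves.Rank1Residual.Mult W' 3 → W'.HasSurjectiveModNGaloisRep 3 → W'.conductorNorm ℤ = N' → Literature.NumberTheory.EllipticCurves.IsImaginaryQuadratic K → Literature.NumberTheory.EllipticCurves.SatisfiesHeegnerHypothesis N' K → Odd (NumberField.discr K) → ¬ 3 ∣ padicValInt 3 W'.minimalDiscriminantInt → ∀ (κ : Literature.NumberTheory.EllipticCurves.ZpExtension K 3), κ.IsAnticyclotomic → ∀ (γ : Field.absoluteGaloisGroup K) [Fact (κ.IsTopGenerator γ)] (𝔭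 : IsDedekindDomain.HeightOneSpectrum (NumberField.RingOfIntegers K)), ((3 : ℕ) : NumberField.RingOfIntegers K) ∈ 𝔭.asIdeal → 𝔭.asIdeal.ramificationIdx (NumberField.RingOfIntegers ℚ) = 1 → 𝔭.asIdeal.inertiaDeg (NumberField.RingOfIntegers ℚ) = 1 → ∀ (𝔭' : IsDedekindDomain.HeightOneSpectrum (NumberField.RingOfIntegers K)), ((3 : ℕ) : NumberField.RingOfIntegers K) ∈ 𝔭'.asIdeal → 𝔭' ≠ 𝔭 → ∀ (ι' : PadicAlgCl 3 ≃+* ℂ), Summit.BirchSwinnertonDyer.BirchSwinnertonDyer.Theorems.SchneiderFree.BranchInducesPrime 3 ι' 𝔭 → ∃ (ΩK : ℂ) (Ωp : ℂ_[3]) (L : Literature.NumberTheory.EllipticCurves.UnrSeries 3), ΩK ≠ 0 ∧ Ωp ≠ 0 ∧ Literature.NumberTheory.EllipticCurves.IsBDPLFunction ι' 𝔭 κ γ Dt'.f ΩK Ωp L ∧ (Module.IsTorsion (Literature.NumberTheory.EllipticCurves.IwasawaAlgebra 3) (Summit.BirchSwinnertonDyer.Rank1Residual.X11b.AcSelmer.XAc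 (W'.baseChange K) 3 κ 𝔭' ∅ γ) → ∀ (g : Literature.NumberTheory.EllipticCurves.UnrSeries 3) (n m : ℕ), (Summit.BirchSwinnertonDyer.Rank1Residual.X11b.AcSelmer.XAc.charIdeal (W'.baseChange K) 3 κ 𝔭' ∅ γ).map (PowerSeries.map (Summit.BirchSwinnertonDyer.Rank1Residual.X11b.Halves.toUnr 3)) = Ideal.span {g} → (∀ i < n, ‖((PowerSeries.coeff i g : Literature.NumberTheory.EllipticCurves.unrIntegers 3) : ℂ_[3])‖ < 1) ∧ ‖((PowerSeries.coeff n g : Literature.NumberTheory.EllipticCurves.unrIntegers 3) : ℂ_[3])‖ = 1 → (∀ i < m, ‖((PowerSeries.coeff i L : Literature.NumberTheory.EllipticCurves.unrIntegers 3) : ℂ_[3])‖ < 1) ∧ ‖((PowerSeries.coeff m L : Literature.NumberTheory.EllipticCurves.unrIntegers 3) : ℂ_[3])‖ = 1 → n ≤ m)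

/-- **The λ-flip (kernel-checked composition, BY NAME).** The rational Eisenstein inclusion (P1) and the one-sided
degree dominance (P2) imply UTD's rational wall 24207. Degenerate frames: `L = 0` and non-torsion `X` (junk
convention `Ch = Λ`, `charIdeal_eq_top_of_not_isTorsion`) satisfy 24207 with `k = 0`. -/
theorem rationalSplitIMCInclusionAtThree_of_eisenstein_of_lambdaDominance
    (hE : EisensteinRationalInclusionAtThree) (hD : CharLambdaDominanceAtThree) :
    Summit.BirchSwinnertonDyer.BirchSwinnertonDyer.Theses.UniversalToricDescent.RationalSplitIMCInclusionAtThree := by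
  intro W _ _ N _ K _ _ Dt hO6 hsurj hr1 hN hK hH κ hκ γ _ 𝔭 h𝔭 he hf 𝔭' h𝔭' hne ι' hι ΩK Ωp L hΩK hΩp hL
  by_cases hL0 : L = 0
  · exact ⟨0, by simp [hL0]⟩
  by_cases htor : Module.IsTorsion (IwasawaAlgebra 3) (AcSelmer.XAc (W.baseChange K) 3 κ 𝔭' ∅ γ)
  · obtain ⟨k, hk⟩ :=
      hE W N K Dt hO6 hsurj hr1 hN hK hH κ hκ γ 𝔭 h𝔭 he hf 𝔭' h𝔭' hne ι' hι ΩK Ωp L hΩK hΩp hL htor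
    obtain ⟨F, F₀, L₀, a, m, c, n, hCh, hF, hF₀, hLeq, hL₀, hmn⟩ :=
      hD W N K Dt hO6 hsurj hr1 hN hK hH κ hκ γ 𝔭 h𝔭 he hf 𝔭' h𝔭' hne ι' hι ΩK Ωp L hΩK hΩp hL htor hL0
    have h3 : (3 : UnrSeries 3) = C ((3 : ℕ) : unrIntegers 3) := by
      rw [map_natCast, Nat.cast_ofNat]
    have h3' : ((3 : ℕ) : UnrSeries 3) = C ((3 : ℕ) : unrIntegers 3) := (map_natCast C 3).symm
    have hFmem : F ∈ (AcSelmer.XAc.charIdeal (W.baseChange K) 3 κ 𝔭' ∅ γ).map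
        (PowerSeries.map (Halves.toUnr 3)) := by
      rw [hCh]; exact Ideal.mem_span_singleton_self F
    have h1 := hk F hFmem
    have hLL₀ : Ideal.span ({L} : Set (UnrSeries 3)) ≤ Ideal.span {L₀} := by
      rw [Ideal.span_singleton_le_span_singleton, hLeq]
      exact Dvd.intro_left _ rfl
    have h2 : C (((3 : ℕ) : unrIntegers 3) ^ (k + a)) * F₀ ∈ Ideal.span ({L₀} : Set (UnrSeries 3)) := by
      have heq : (3 : UnrSeries 3) ^ k * F = C (((3 : ℕ) : unrIntegers 3) ^ (k + a)) * F₀ := by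
        rw [hF, h3, pow_add, map_mul, map_pow, map_pow]; ring
      rw [← heq]; exact hLL₀ h1
    obtain ⟨hspan, -⟩ := span_singleton_eq_of_C_pow_mul_mem_of_le (p := 3) h2 hL₀ hF₀ hmn
    have hL₀mem : L₀ ∈ Ideal.span ({F₀} : Set (UnrSeries 3)) := by
      rw [← hspan]; exact Ideal.mem_span_singleton_self L₀
    obtain ⟨h, hh⟩ := Ideal.mem_span_singleton'.mp hL₀mem
    refine ⟨a, ?_⟩
    rw [hCh, Ideal.mem_span_singleton']
    refine ⟨C (((3 : ℕ) : unrIntegers 3) ^ c) * h, ?_⟩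
    rw [hLeq, ← hh, hF, h3', ← map_pow]; ring
  · refine ⟨0, ?_⟩
    have htop : AcSelmer.XAc.charIdeal (W.baseChange K) 3 κ 𝔭' ∅ γ = ⊤ :=
      Summit.BirchSwinnertonDyer.BirchSwinnertonDyer.Theorems.charIdeal_eq_top_of_not_isTorsion (p := 3) _ htor
    rw [htop, Ideal.map_top]; exact Submodule.mem_top

end Summit.BirchSwinnertonDyer.BirchSwinnertonDyer.Cruxes.RationalSplitIMCInclusionAtThree.EisensteinKatoSwap

end
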